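import Literature.IUT.HodgeArakelov.BadPrimeGaussianMonoidsGenuineRecordRestrictionIsoPair
import Literature.IUT.HodgeArakelov.BadPrimeGaussianMonoidsGenuineRecordSplittingProofs

/-!
# [IUTchII] Prop 3.1 (i) «splittings up to torsion» (sub-DAG junction J3) at the genuine `θ_env` data over `ℚ̄_pˣ` for the
# pointed-inversion PAIR family — abc-iut-w4-d004 gen 3's `splitting_toRecord_padic_of_eval` (p433555) with `horb` AND `htors`
# DISCHARGED (proof-only; row «COR35ii-HORB-GENUINE», file 8)

S. Mochizuki, *Inter-universal Teichmüller theory II*, kurims Dec-2020 manuscript, Prop 3.1 (i) p. 87 («splittings up to torsion»),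
Cor 2.8 (i) p. 82, Prop 2.2 (ii) p. 66 [cite: Mochizuki2012, Prop 3.1 (i) p.87]. Claim key DISPUTED (D-0012). PROOF-ONLY companion (abc-iut
cell, layer L6, seat abc-iut-w4-d004 gen 4; node **IUTchII:Prop3.1(i)**, sub-DAG `plan/L6/SUBDAG-IUTchII-Prop-31-33-34.md` junction J3).
NO definition, NO `Prop` fact, NO instance. TWO theorems: `thetaEnv_toRecord_nonempty_pairRhoLim` — NON-VACUITY of the `θ`-binder:
`θ^{i₀}_env(𝕄_*) ≠ ∅` at ANY produced record for the pair family (from file 2's `thetaIota_nonempty_pairRho`) — and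
**`splitting_toRecord_padic_of_eval_pairRhoLim`** = p433555's statement VERBATIM
with the binders `horb`, `htors` replaced by their derivations — `horb_toRecord_pairRhoLim` (file 1: (R1)(R2)(R3) of [IUTchII] Prop 2.2 (ii)
at the model + `hker`) and abc-iut-w5-d192's `htors_toRecord_family` (bijective `c`, `μ ⊆ O`). Remaining inputs: ONE evaluation section
`s₀` (+ `hact`, finite-index `ε`-image), `c`/`c₀` bijective with the same underlying map, (E) `R₀ θ = κ₀ q` with `q` a non-unit,
(R1)(R2)(R3), `hker`, `μ ⊆ O`. HONEST FRAMING: composition of landed theorems; no side taken on [IUTchIII] Cor 3.12; typed ≠ proved.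
-/

noncomputable section

namespace Literature.IUT.HodgeArakelov

namespace EtaleLevels

open Literature.AnabelianGeometry.EtaleTheta CohomologySystemOfContH1 EtaleThetaDataOfSetting TemperedThetaMonoids
  BadPrimeGaussianMonoids

variable {p : ℕ} [Fact p.Prime] {D : Literature.AnabelianGeometry.EtaleTheta.ThetaSetting p}
  {E : D.EtaleThetaData} {l : ℕ} (C : E.DoubleUnderline l) (hC : D.Compat) (hS : D.Sec2Hyps)
  (hl : l.Prime) (hp2 : p ≠ 2) (hpl : p ≠ l) (hζ : ∃ ζ : D.K, IsPrimitiveRoot ζ (4 * l))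
  (mods : ∀ M : ℕ+, D.CyclotomeMod l M)
  (f : contCocycles D.toTheta D.DeltaTheta C.GtpYdduu) (hf : f ∈ C.rootCocycles hC)
  (hmods : ∀ (M M' : ℕ+) (h : (M : ℕ) ∣ (M' : ℕ)) (x : D.lDeltaTheta l),
    MuN.red p M M' h ((mods M').red x) = (mods M).red x)
  (h15 : Literature.AnabelianGeometry.EtaleTheta.ThetaSetting.Prop15iii E hC) (L : C.CuspLabels)
  (hZ : ∀ M : ℕ+, Nonempty (ModelCyclotomes.lDeltaQuot (C.rigidData (mods M) hC hS h15 L) ≃*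
    Literature.IUT.HodgeTheaters.ZHat))
  (hcharY : EtaleThetaDataOfSetting.PiYddCharacteristic C)
  (hlim : Function.Bijective (rigidLimHom C hC hS hl hp2 hpl hζ mods f hf hmods h15 L hZ))
  [(EtaleThetaDataOfSetting.PiYdd C).Normal]
  {Iota : Type}
  (iota : Iota → ((thetaEnvData C hC hS hl hp2 hpl hζ mods f hf hmods h15 L hZ hcharY hlim).D.coh.lim ≃+
    (thetaEnvData C hC hS hl hp2 hpl hζ mods f hf hmods h15 L hZ hcharY hlim).D.coh.lim))
  {P₀ : TopGroup.{0}} (φ₀ : P₀ →* D.GtpTheta) (s₀ : P₀ →* Pi C)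
  (hι : Continuous ((MonoidHom.id (Pi C)).comp s₀))
  (hN : (⊤ : Subgroup P₀).map ((MonoidHom.id (Pi C)).comp s₀) ≤ PiYdd C)
  (hφ : (phi C).comp ((MonoidHom.id (Pi C)).comp s₀) = φ₀)
  [TopologicalSpace (PadicAlgCl p)ˣ]
  (c : CyclotomeCoefficients (phi C) (D.lDeltaTheta l) (PadicAlgCl p)ˣ)
  (hA : ∀ b : (PadicAlgCl p)ˣ, IsOpen (MulAction.stabilizer (Pi C) b : Set (Pi C)))
  (hfi : ∀ b : (PadicAlgCl p)ˣ, (MulAction.stabilizer (Pi C) b).FiniteIndex)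
  (O : Submonoid (PadicAlgCl p)ˣ)
  [MulDistribMulAction P₀ (PadicAlgCl p)ˣ]
  (c₀ : CyclotomeCoefficients φ₀ (D.lDeltaTheta l) (PadicAlgCl p)ˣ)
  (hA₀ : ∀ b : (PadicAlgCl p)ˣ, IsOpen (MulAction.stabilizer P₀ b : Set P₀))
  (hfi₀ : ∀ b : (PadicAlgCl p)ˣ, (MulAction.stabilizer P₀ b).FiniteIndex)

/-- **[IUTchII] Prop 3.1 (i) «splittings up to torsion» AT THE GENUINE `θ_env` DATA over `ℚ̄_pˣ`, `horb` and `htors` DISCHARGED**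
(pointed-inversion pair family, `iota i₀ = pairRhoLim C αι βι …`): `IsSplittingUpToTorsion M^×_TM ⟨∞θ^{i₀}_env⟩` and
`IsSplittingUpToTorsion M^×_TM ⟨θ^{i₀}_env⟩` for the record `(thetaEnvData …).toRecord (h1LimConjMulAut …) (h1LimKummerOn c hA hfi O) iota`
— abc-iut-w4-d004 gen 3's `splitting_toRecord_padic_of_eval` fed with `horb_toRecord_pairRhoLim` and `htors_toRecord_family`.
[cite: Mochizuki2012, Prop 3.1 (i) p.87] -/
theorem splitting_toRecord_padic_of_eval_pairRhoLim (hc : Function.Bijective c.hom)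
    -- `μ ⊆ O` (with inverses): `htors` discharged
    (hOtors : ∀ a : (PadicAlgCl p)ˣ, IsOfFinOrder a → a ∈ O ∧ a⁻¹ ∈ O)
    -- (R1) the pointed-inversion PAIR, reversing the `ℤ`-torsor: `horb` discharged
    (αι : (Pi C) ≃ₜ* (Pi C)) (βι : D.GtpTheta ≃ₜ* D.GtpTheta) (hφαβ : ∀ g, βι (phi C g) = phi C (αι g))
    (hAβ : ∀ a : D.GtpTheta, a ∈ D.lDeltaTheta l ↔ βι a ∈ D.lDeltaTheta l)
    (hH : ∀ x, x ∈ PiYdd C ↔ αι x ∈ PiYdd C)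
    (γ ε : Pi C) (hγ : C.toLZ γ = Multiplicative.ofAdd 1) (hε₁ : (ε : D.PiTemp) ∈ D.GtpY)
    (hε₂ : (ε : D.PiTemp) ∉ D.GtpYdd) (hαγ : C.toLZ (αι γ) = Multiplicative.ofAdd (-1))
    -- (R2)(R3) [EtTh] Prop 1.4 at the class level
    (hsign : ∃ κ : ContH1 (phi C) (D.lDeltaTheta l) (PiYdd C ⊓ ⊤), κ ^ 2 = 1 ∧
      ContH1.conj (phi C) (D.lDeltaTheta l) ε (rootLiftClass C) = rootLiftClass C * κ)
    (hroot : ∃ τ₀ : Pi C, (τ₀ : D.PiTemp) ∈ D.GtpY ∧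
      h1TopAut (phi C) (D.lDeltaTheta l) (PiYdd C) αι βι hφαβ (fun a ha => (hAβ a).mp ha) hH (rootLiftClass C) =
        ContH1.conj (phi C) (D.lDeltaTheta l) τ₀ (rootLiftClass C))
    (hfree : ∀ m n : ℤ, IsOfFinAddOrder
      ((h1Top C).symm (Additive.ofMul (ContH1.conj (phi C) (D.lDeltaTheta l) (γ ^ m) (rootLiftClass C))) -
        (h1Top C).symm (Additive.ofMul (ContH1.conj (phi C) (D.lDeltaTheta l) (γ ^ n) (rootLiftClass C)))) →
      m = n)
    (hker : ∀ y : (coh C).H1 ⊤, (coh C).toLim ⊤ y = 0 → IsOfFinAddOrder y)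
    (hc₀ : Function.Bijective c₀.hom) (hc₀c : ∀ ζ, c₀.hom ζ = c.hom ζ)
    (hact : ∀ (g : P₀) (a : (PadicAlgCl p)ˣ), g • a = s₀ g • a)
    [((EtaleThetaDataOfSetting.aug C).comp s₀).range.FiniteIndex]
    {i₀ : Iota} (hi₀ : iota i₀ = pairRhoLim C αι βι hφαβ hAβ hH)
    {θ : ((thetaEnvData C hC hS hl hp2 hpl hζ mods f hf hmods h15 L hZ hcharY hlim).toRecord
        (h1LimConjMulAut (phi C) (D.lDeltaTheta l) (PiYdd C))
        (h1LimKummerOn (phi C) (D.lDeltaTheta l) (PiYdd C) c hA hfi O) iota).H}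
    (hθ : θ ∈ ((thetaEnvData C hC hS hl hp2 hpl hζ mods f hf hmods h15 L hZ hcharY hlim).toRecord
        (h1LimConjMulAut (phi C) (D.lDeltaTheta l) (PiYdd C))
        (h1LimKummerOn (phi C) (D.lDeltaTheta l) (PiYdd C) c hA hfi O) iota).thetaEnv i₀)
    (R₀ : ((thetaEnvData C hC hS hl hp2 hpl hζ mods f hf hmods h15 L hZ hcharY hlim).toRecord
        (h1LimConjMulAut (phi C) (D.lDeltaTheta l) (PiYdd C))
        (h1LimKummerOn (phi C) (D.lDeltaTheta l) (PiYdd C) c hA hfi O) iota).H →*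
      Multiplicative (h1Lim φ₀ (D.lDeltaTheta l) (⊤ : Subgroup P₀) ⊥))
    (hR₀ : ∀ y, Multiplicative.toAdd (R₀ y) =
      h1LimCongr (D.lDeltaTheta l) ⊤ hφ ⊥
        (h1LimComap (phi C) (D.lDeltaTheta l) ((MonoidHom.id (Pi C)).comp s₀) hι hN
          (AddEquiv.additiveMultiplicative (h1Lim (phi C) (D.lDeltaTheta l) (PiYdd C) ⊥) (Additive.ofMul y))))
    (q : O) (hRθ : R₀ θ = h1LimKummerOn φ₀ (D.lDeltaTheta l) ⊤ c₀ hA₀ hfi₀ O q) (hq : ¬ IsUnit q) :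
    IsSplittingUpToTorsion
        ((thetaEnvData C hC hS hl hp2 hpl hζ mods f hf hmods h15 L hZ hcharY hlim).toRecord
          (h1LimConjMulAut (phi C) (D.lDeltaTheta l) (PiYdd C))
          (h1LimKummerOn (phi C) (D.lDeltaTheta l) (PiYdd C) c hA hfi O) iota).units
        (Submonoid.closure (((thetaEnvData C hC hS hl hp2 hpl hζ mods f hf hmods h15 L hZ hcharY hlim).toRecord
          (h1LimConjMulAut (phi C) (D.lDeltaTheta l) (PiYdd C))
          (h1LimKummerOn (phi C) (D.lDeltaTheta l) (PiYdd C) c hA hfi O) iota).inftyThetaEnv i₀)) ∧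
      IsSplittingUpToTorsion
        ((thetaEnvData C hC hS hl hp2 hpl hζ mods f hf hmods h15 L hZ hcharY hlim).toRecord
          (h1LimConjMulAut (phi C) (D.lDeltaTheta l) (PiYdd C))
          (h1LimKummerOn (phi C) (D.lDeltaTheta l) (PiYdd C) c hA hfi O) iota).units
        (Submonoid.closure (((thetaEnvData C hC hS hl hp2 hpl hζ mods f hf hmods h15 L hZ hcharY hlim).toRecord
          (h1LimConjMulAut (phi C) (D.lDeltaTheta l) (PiYdd C))
          (h1LimKummerOn (phi C) (D.lDeltaTheta l) (PiYdd C) c hA hfi O) iota).thetaEnv i₀)) :=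
  splitting_toRecord_padic_of_eval C hC hS hl hp2 hpl hζ mods f hf hmods h15 L hZ hcharY hlim iota φ₀ s₀ hι hN hφ c hA hfi O c₀
    hA₀ hfi₀ hc hc₀ hc₀c hact hθ
    (horb_toRecord_pairRhoLim C hC hS hl hp2 hpl hζ mods f hf hmods h15 L hZ hcharY hlim iota c hA hfi O hc hOtors αι βι hφαβ hAβ
      hH γ ε hγ hε₁ hε₂ hαγ hsign hroot hfree hker hi₀ hθ)
    (htors_toRecord_family C hC hS hl hp2 hpl hζ mods f hf hmods h15 L hZ hcharY hlim iota c hA hfi O hc hOtors) R₀ hR₀ q hRθ hq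

/-! ### Non-vacuity of the `θ`-binder: `θ^{i₀}_env(𝕄_*) ≠ ∅` at the genuine record for the pair family -/

section Nonempty

variable {M : Type} [CommMonoid M]
  (act : (modelSystem C hC hS hl hp2 hpl hζ mods f hf hmods h15 L hZ).PiX →*
    MulAut (Multiplicative (thetaEnvData C hC hS hl hp2 hpl hζ mods f hf hmods h15 L hZ hcharY hlim).cohEnv.lim))
  (κ : M →* Multiplicative (thetaEnvData C hC hS hl hp2 hpl hζ mods f hf hmods h15 L hZ hcharY hlim).cohEnv.lim)

omit [TopologicalSpace (PadicAlgCl p)ˣ] in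
/-- **`θ^{i₀}_env(𝕄_*)` IS NONEMPTY at the genuine record for the pointed-inversion pair family** ([IUTchII] Prop 2.2 (ii) p. 66 «a
specific `μ_{2l}`-orbit `θ^ι(Π_v)`» — in particular nonempty; Prop 3.1 (i) p. 87): for ANY produced record
`(thetaEnvData …).toRecord act κ iota` with `iota i₀ = pairRhoLim C αι βι …`, the set `θ^{i₀}_env` is inhabited — by the transport of
the image in `lim_J` of the `pairRho`-invariant (up to torsion) class `−η̲̈^Θ` (file 2's `thetaIota_nonempty_pairRho`, from (R1) and (R2)
`hsign`/`hroot`). So the `θ`-binders `hθ : θ ∈ θ^{i₀}_env(𝕄_*)` of this row's capstones are NOT vacuous. [cite: Mochizuki2012, Prop 3.1 (i) p.87] -/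
theorem thetaEnv_toRecord_nonempty_pairRhoLim
    (αι : (Pi C) ≃ₜ* (Pi C)) (βι : D.GtpTheta ≃ₜ* D.GtpTheta) (hφαβ : ∀ g, βι (phi C g) = phi C (αι g))
    (hAβ : ∀ a : D.GtpTheta, a ∈ D.lDeltaTheta l ↔ βι a ∈ D.lDeltaTheta l)
    (hH : ∀ x, x ∈ PiYdd C ↔ αι x ∈ PiYdd C)
    (γ ε : Pi C) (hγ : C.toLZ γ = Multiplicative.ofAdd 1) (hε₁ : (ε : D.PiTemp) ∈ D.GtpY)
    (hε₂ : (ε : D.PiTemp) ∉ D.GtpYdd) (hαγ : C.toLZ (αι γ) = Multiplicative.ofAdd (-1))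
    (hsign : ∃ κ' : ContH1 (phi C) (D.lDeltaTheta l) (PiYdd C ⊓ ⊤), κ' ^ 2 = 1 ∧
      ContH1.conj (phi C) (D.lDeltaTheta l) ε (rootLiftClass C) = rootLiftClass C * κ')
    (hroot : ∃ τ₀ : Pi C, (τ₀ : D.PiTemp) ∈ D.GtpY ∧
      h1TopAut (phi C) (D.lDeltaTheta l) (PiYdd C) αι βι hφαβ (fun a ha => (hAβ a).mp ha) hH (rootLiftClass C) =
        ContH1.conj (phi C) (D.lDeltaTheta l) τ₀ (rootLiftClass C))
    {i₀ : Iota} (hi₀ : iota i₀ = pairRhoLim C αι βι hφαβ hAβ hH) :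
    (((thetaEnvData C hC hS hl hp2 hpl hζ mods f hf hmods h15 L hZ hcharY hlim).toRecord act κ iota).thetaEnv i₀).Nonempty := by
  obtain ⟨t, ht, hinv⟩ := thetaIota_nonempty_pairRho C hC hS hcharY (setting C hC hS hl hp2 hpl hζ mods f hf)
    (ContinuousMulEquiv.refl _) rfl αι βι hφαβ hAβ hH γ ε hγ hε₁ hε₂ hαγ hsign hroot
  have hx : (thetaEnvData C hC hS hl hp2 hpl hζ mods f hf hmods h15 L hZ hcharY hlim).transportLim.symm
      (Multiplicative.toAdd (Multiplicative.ofAdd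
        ((thetaEnvData C hC hS hl hp2 hpl hζ mods f hf hmods h15 L hZ hcharY hlim).transportLim ((coh C).toLim ⊤ t)))) ∈
      (thetaEnvData C hC hS hl hp2 hpl hζ mods f hf hmods h15 L hZ hcharY hlim).thetaIotaLim (iota i₀) := by
    rw [toAdd_ofAdd, AddEquiv.symm_apply_apply, ThetaEnvData.mem_thetaIotaLim_iff, hi₀]
    refine ⟨⟨t, ht, rfl⟩, ?_⟩
    have h2 := ((coh C).toLim ⊤).isOfFinAddOrder hinv
    rw [map_sub, toLim_pairRho] at h2
    exact h2
  exact ⟨_, ((thetaEnvData C hC hS hl hp2 hpl hζ mods f hf hmods h15 L hZ hcharY hlim).mem_envSet_iff _ _).mpr hx⟩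

end Nonempty

end EtaleLevels

end Literature.IUT.HodgeArakelov

end
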